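import Mathlib
import Literature.AlgebraicGeometry.Resolution.ValuedFunctionFieldsLemmas

/-!
# Crux `RtdLocal` (stmt-ResolutionOfSingularities-18840), line `Sketch` — stub `stub_cotangent_span`

A presentation of `B` inside `m' ∩ B` spans the cotangent space `m' / m'²` of `B' = B[s⁻¹]`.

Setting: `B ⊆ K` a `k`-subalgebra of a field, `0 ≠ s ∈ B`, `B' := Algebra.adjoin k (↑B ∪ {s⁻¹})`,
`incl : B →ₐ[k] B'` the inclusion, `m'` a proper ideal of `B'` with residue ring `k` in the weak
sense (every element of `B'` is congruent to a constant modulo `m'`), `m := m' ∩ B`, and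
`g₀ : J → B` a finite family generating `B` as a `k`-algebra and lying in `m`.

Claim (`stub_cotangent_span`): every `x ∈ m'` satisfies `x ≡ Σ_j u_j · incl (g₀ j) (mod m'²)`
with constant coefficients `u_j ∈ k`.

Proof.
* `B' = B[1/s]` elementwise (`Literature…locAway_eq_adjoin`): `x = incl b · (s⁻¹)ⁿ` with
  `b = x sⁿ ∈ B`; since `x ∈ m'`, `incl b = x · sⁿ ∈ m'`, so `b ∈ m`.
* First-order Taylor expansion in `B` (`cotspan_firstOrder`, by `Algebra.adjoin_induction`):
  every `y ∈ B` is `≡ c + Σ u_j g₀ j (mod m²)` with `c, u_j ∈ k`; for `y ∈ m` the constant `c`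
  vanishes because `m` is proper (`cotspan_firstOrder_of_mem`).
* `(s⁻¹)ⁿ ≡ c'' (mod m')`, hence
  `x = incl b · (s⁻¹)ⁿ ≡ c'' · Σ u_j incl (g₀ j) (mod m'²)`.
-/

set_option linter.dupNamespace false

namespace Summit.ResolutionOfSingularities.ResolutionOfSingularities.Theorems

open Literature.AlgebraicGeometry.Resolution in
/-- Elements of `B[s⁻¹] = Algebra.adjoin k (↑B ∪ {s⁻¹}) ⊆ K` are fractions `b / s ^ n` with
`b ∈ B`: for every `x` in it, `x * s ^ n ∈ B` for some `n`. -/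
theorem cotspan_exists_mul_pow_mem {k K : Type*} [Field k] [Field K] [Algebra k K]
    (B : Subalgebra k K) {s : K} (hs : s ∈ B) (hs0 : s ≠ 0) {x : K}
    (hx : x ∈ Algebra.adjoin k ((B : Set K) ∪ {s⁻¹})) : ∃ n : ℕ, x * s ^ n ∈ B := by
  have h : locAway B s hs = Algebra.adjoin k ((B : Set K) ∪ {s⁻¹}) := by
    rw [Set.union_singleton]
    exact locAway_eq_adjoin hs0 (Algebra.adjoin_eq B)
  rw [← h] at hx
  exact hx

/-- First-order Taylor expansion along a generating family: if `g : J → A` generates the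
`k`-algebra `A` and lies in the ideal `m`, then every `y : A` is congruent modulo `m ^ 2` to
`c + Σ_j u_j g_j` with constants `c, u_j ∈ k`. -/
theorem cotspan_firstOrder {k A : Type*} [Field k] [CommRing A] [Algebra k A]
    (m : Ideal A) {J : Type*} [Fintype J] (g : J → A) (hg : ∀ j, g j ∈ m)
    (hgen : Algebra.adjoin k (Set.range g) = ⊤) (y : A) :
    ∃ (c : k) (u : J → k),
      y - algebraMap k A c - ∑ j, algebraMap k A (u j) * g j ∈ m ^ 2 := by
  classical
  have hy : y ∈ Algebra.adjoin k (Set.range g) := by rw [hgen]; exact Algebra.mem_top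
  induction hy using Algebra.adjoin_induction with
  | mem x hx =>
    obtain ⟨j, rfl⟩ := hx
    refine ⟨0, Pi.single j 1, ?_⟩
    have hsum : ∑ i, algebraMap k A (Pi.single (M := fun _ => k) j 1 i) * g i = g j := by
      rw [Fintype.sum_eq_single j fun i hi => by rw [Pi.single_eq_of_ne hi, map_zero, zero_mul]]
      rw [Pi.single_eq_same, map_one, one_mul]
    rw [hsum, map_zero, sub_zero, sub_self]
    exact zero_mem _
  | algebraMap r => exact ⟨r, 0, by simp⟩
  | add x y _ _ ihx ihy =>
    obtain ⟨c₁, u₁, h₁⟩ := ihx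
    obtain ⟨c₂, u₂, h₂⟩ := ihy
    refine ⟨c₁ + c₂, u₁ + u₂, ?_⟩
    have key : x + y - algebraMap k A (c₁ + c₂) - ∑ j, algebraMap k A ((u₁ + u₂) j) * g j
        = (x - algebraMap k A c₁ - ∑ j, algebraMap k A (u₁ j) * g j)
          + (y - algebraMap k A c₂ - ∑ j, algebraMap k A (u₂ j) * g j) := by
      simp only [Pi.add_apply, map_add, add_mul, Finset.sum_add_distrib]
      ring
    rw [key]
    exact add_mem h₁ h₂
  | mul x y _ _ ihx ihy =>
    obtain ⟨c₁, u₁, h₁⟩ := ihx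
    obtain ⟨c₂, u₂, h₂⟩ := ihy
    refine ⟨c₁ * c₂, fun j => c₁ * u₂ j + c₂ * u₁ j, ?_⟩
    have hℓ₁ : ∑ j, algebraMap k A (u₁ j) * g j ∈ m :=
      Ideal.sum_mem _ fun j _ => m.mul_mem_left _ (hg j)
    have hℓ₂ : ∑ j, algebraMap k A (u₂ j) * g j ∈ m :=
      Ideal.sum_mem _ fun j _ => m.mul_mem_left _ (hg j)
    have hsum : ∑ j, algebraMap k A (c₁ * u₂ j + c₂ * u₁ j) * g j
        = algebraMap k A c₁ * ∑ j, algebraMap k A (u₂ j) * g j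
          + algebraMap k A c₂ * ∑ j, algebraMap k A (u₁ j) * g j := by
      simp only [map_add, map_mul, add_mul, mul_assoc, Finset.sum_add_distrib, Finset.mul_sum]
    have key : x * y - algebraMap k A (c₁ * c₂)
          - ∑ j, algebraMap k A (c₁ * u₂ j + c₂ * u₁ j) * g j
        = algebraMap k A c₁ * (y - algebraMap k A c₂ - ∑ j, algebraMap k A (u₂ j) * g j)
          + (∑ j, algebraMap k A (u₁ j) * g j) * (∑ j, algebraMap k A (u₂ j) * g j)
          + (∑ j, algebraMap k A (u₁ j) * g j)
            * (y - algebraMap k A c₂ - ∑ j, algebraMap k A (u₂ j) * g j)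
          + (x - algebraMap k A c₁ - ∑ j, algebraMap k A (u₁ j) * g j) * y := by
      rw [hsum, map_mul]
      ring
    rw [key]
    refine add_mem (add_mem (add_mem ((m ^ 2).mul_mem_left _ h₂) ?_)
      ((m ^ 2).mul_mem_left _ h₂)) ((m ^ 2).mul_mem_right _ h₁)
    rw [pow_two]
    exact Ideal.mul_mem_mul hℓ₁ hℓ₂

/-- For elements of a PROPER ideal `m` the constant term of the first-order expansion
(`cotspan_firstOrder`) vanishes: `y ≡ Σ_j u_j g_j (mod m ^ 2)` with `u_j ∈ k`. -/
theorem cotspan_firstOrder_of_mem {k A : Type*} [Field k] [CommRing A] [Algebra k A]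
    (m : Ideal A) (hm : m ≠ ⊤) {J : Type*} [Fintype J] (g : J → A) (hg : ∀ j, g j ∈ m)
    (hgen : Algebra.adjoin k (Set.range g) = ⊤) (y : A) (hy : y ∈ m) :
    ∃ u : J → k, y - ∑ j, algebraMap k A (u j) * g j ∈ m ^ 2 := by
  obtain ⟨c, u, h⟩ := cotspan_firstOrder m g hg hgen y
  refine ⟨u, ?_⟩
  by_cases hc : c = 0
  · simpa [hc] using h
  · exfalso
    apply hm
    have h1 : y - algebraMap k A c - ∑ j, algebraMap k A (u j) * g j ∈ m :=
      Ideal.pow_le_self two_ne_zero h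
    have h2 : ∑ j, algebraMap k A (u j) * g j ∈ m :=
      Ideal.sum_mem _ fun j _ => m.mul_mem_left _ (hg j)
    have h3 : algebraMap k A c
        = y - (y - algebraMap k A c - ∑ j, algebraMap k A (u j) * g j)
          - ∑ j, algebraMap k A (u j) * g j := by ring
    have hcm : algebraMap k A c ∈ m := by
      rw [h3]
      exact sub_mem (sub_mem hy h1) h2
    exact m.eq_top_of_isUnit_mem hcm ((IsUnit.mk0 c hc).map (algebraMap k A))

/-- Abstract form of `stub_cotangent_span`: `B ≤ B'` subalgebras of the field `K` with
`s ∈ B`, `s⁻¹ ∈ B'` and `B' ⊆ B[1/s]` elementwise; `m'` a proper ideal of `B'` with residue ring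
`k`; `g₀ ⊆ m' ∩ B` generating `B`. Then `g₀` spans `m' / m'²` with constant coefficients. -/
theorem cotspan_span_of_le {k K : Type*} [Field k] [Field K] [Algebra k K]
    {B B' : Subalgebra k K} (hle : B ≤ B') {s : K} (hs : s ∈ B) (hs0 : s ≠ 0) (hs' : s⁻¹ ∈ B')
    (hB' : ∀ x ∈ B', ∃ n : ℕ, x * s ^ n ∈ B)
    (m' : Ideal ↥B') (hm' : m' ≠ ⊤)
    (hres : ∀ x : ↥B', ∃ c : k, x - algebraMap k ↥B' c ∈ m')
    {J : Type*} [Fintype J] (g₀ : J → ↥B)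
    (hg₀ : ∀ j, g₀ j ∈ m'.comap (Subalgebra.inclusion hle))
    (hgen₀ : Algebra.adjoin k (Set.range g₀) = ⊤)
    (x : ↥B') (hx : x ∈ m') :
    ∃ u : J → k,
      x - ∑ j, algebraMap k ↥B' (u j) * Subalgebra.inclusion hle (g₀ j) ∈ m' ^ 2 := by
  have hmtop : m'.comap (Subalgebra.inclusion hle) ≠ ⊤ := Ideal.comap_ne_top _ hm'
  -- `s` and `s⁻¹` as elements of `B'`
  obtain ⟨σ, hσ⟩ : ∃ σ : ↥B', (σ : K) = s := ⟨⟨s, hle hs⟩, rfl⟩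
  obtain ⟨τ, hτ⟩ : ∃ τ : ↥B', (τ : K) = s⁻¹ := ⟨⟨s⁻¹, hs'⟩, rfl⟩
  -- `x = incl b * τ ^ n` with `b = x * s ^ n ∈ B`
  obtain ⟨n, hn⟩ := hB' x x.2
  obtain ⟨b, hb⟩ : ∃ b : ↥B, (b : K) = x * s ^ n := ⟨⟨_, hn⟩, rfl⟩
  have hxb : x = Subalgebra.inclusion hle b * τ ^ n := by
    apply Subtype.ext
    rw [Subalgebra.coe_mul, Subalgebra.coe_pow, Subalgebra.coe_inclusion, hb, hτ, mul_assoc,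
      ← mul_pow, mul_inv_cancel₀ hs0, one_pow, mul_one]
  have hbx : Subalgebra.inclusion hle b = x * σ ^ n := by
    apply Subtype.ext
    rw [Subalgebra.coe_mul, Subalgebra.coe_pow, Subalgebra.coe_inclusion, hb, hσ]
  have hbm : b ∈ m'.comap (Subalgebra.inclusion hle) := by
    rw [Ideal.mem_comap, hbx]
    exact m'.mul_mem_right _ hx
  -- first-order expansion of `b` in `B`, pushed into `B'`
  obtain ⟨u, hu⟩ := cotspan_firstOrder_of_mem _ hmtop g₀ hg₀ hgen₀ b hbm
  have hq : Subalgebra.inclusion hle b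
      - ∑ j, algebraMap k ↥B' (u j) * Subalgebra.inclusion hle (g₀ j) ∈ m' ^ 2 := by
    have h2 := Ideal.le_comap_pow (Subalgebra.inclusion hle) 2 hu
    rw [Ideal.mem_comap, map_sub, map_sum] at h2
    simpa only [map_mul, AlgHom.commutes] using h2
  -- the constant term of `τ ^ n`
  obtain ⟨c, hc⟩ := hres (τ ^ n)
  have hL : ∑ j, algebraMap k ↥B' (u j) * Subalgebra.inclusion hle (g₀ j) ∈ m' :=
    Ideal.sum_mem _ fun j _ => m'.mul_mem_left _ (hg₀ j)
  have hsum : ∑ j, algebraMap k ↥B' (c * u j) * Subalgebra.inclusion hle (g₀ j)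
      = algebraMap k ↥B' c * ∑ j, algebraMap k ↥B' (u j) * Subalgebra.inclusion hle (g₀ j) := by
    rw [Finset.mul_sum]
    simp only [map_mul, mul_assoc]
  have key : x - ∑ j, algebraMap k ↥B' (c * u j) * Subalgebra.inclusion hle (g₀ j)
      = (∑ j, algebraMap k ↥B' (u j) * Subalgebra.inclusion hle (g₀ j))
          * (τ ^ n - algebraMap k ↥B' c)
        + (Subalgebra.inclusion hle b
            - ∑ j, algebraMap k ↥B' (u j) * Subalgebra.inclusion hle (g₀ j)) * τ ^ n := by
    rw [hsum, hxb]
    ring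
  have hmem : (∑ j, algebraMap k ↥B' (u j) * Subalgebra.inclusion hle (g₀ j))
          * (τ ^ n - algebraMap k ↥B' c)
        + (Subalgebra.inclusion hle b
            - ∑ j, algebraMap k ↥B' (u j) * Subalgebra.inclusion hle (g₀ j)) * τ ^ n
      ∈ m' ^ 2 := by
    refine add_mem ?_ ((m' ^ 2).mul_mem_right _ hq)
    rw [pow_two]
    exact Ideal.mul_mem_mul hL hc
  refine ⟨fun j => c * u j, ?_⟩
  beta_reduce
  rw [key]
  exact hmem

/-- COTANGENT-SPAN: with `B' = B[s⁻¹]`, `m'` a proper ideal of `B'` with residue field `k`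
(`hres`) and `g₀ ⊆ m' ∩ B` a presentation of `B`, every `x ∈ m'` is `≡ Σ u_j g₀_j (mod m'²)`
with CONSTANT coefficients: `x = b s⁻ᵉ` with `b = x sᵉ ∈ m' ∩ B = (g₀) + (m' ∩ B)²`-part,
and `s⁻ᵉ ≡ c'' (mod m')`. -/
theorem stub_cotangent_span {k K : Type} [Field k] [Field K] [Algebra k K]
    (B : Subalgebra k K) (s : K) (hs : s ∈ B) (hs0 : s ≠ 0)
    (hle : B ≤ Algebra.adjoin k ((B : Set K) ∪ {s⁻¹}))
    (m' : Ideal ↥(Algebra.adjoin k ((B : Set K) ∪ {s⁻¹}))) (hm' : m' ≠ ⊤)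
    (hres : ∀ x : ↥(Algebra.adjoin k ((B : Set K) ∪ {s⁻¹})), ∃ c : k,
      x - algebraMap k ↥(Algebra.adjoin k ((B : Set K) ∪ {s⁻¹})) c ∈ m')
    {J : Type} [Fintype J] (g₀ : J → ↥B)
    (hg₀ : ∀ j, g₀ j ∈ m'.comap (Subalgebra.inclusion hle))
    (hgen₀ : Algebra.adjoin k (Set.range fun j => (g₀ j : K)) = B)
    (x : ↥(Algebra.adjoin k ((B : Set K) ∪ {s⁻¹}))) (hx : x ∈ m') :
    ∃ u : J → k, x - ∑ j, algebraMap k ↥(Algebra.adjoin k ((B : Set K) ∪ {s⁻¹})) (u j) *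
      Subalgebra.inclusion hle (g₀ j) ∈ m' ^ 2 := by
  -- the presentation generates `B`, read inside `↥B`
  have htop : Algebra.adjoin k (Set.range g₀) = ⊤ := by
    apply Subalgebra.map_injective (f := B.val) Subtype.val_injective
    rw [Algebra.map_top, Subalgebra.range_val, AlgHom.map_adjoin, ← Set.range_comp]
    exact hgen₀
  exact cotspan_span_of_le hle hs hs0 (Algebra.subset_adjoin (Set.mem_union_right _ rfl))
    (fun y hy => cotspan_exists_mul_pow_mem B hs hs0 hy) m' hm' hres g₀ hg₀ htop x hx

end Summit.ResolutionOfSingularities.ResolutionOfSingularities.Theorems
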